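import Literature.AlgebraicGeometry.Hu2025.Statements.S06WpEllBlowups.R108bProp611Items
import Mathlib.Algebra.MvPolynomial.Nilpotent
import Mathlib.RingTheory.AlgebraicIndependent.Transcendental
import Mathlib.RingTheory.Ideal.Maximal
import HarnessLib

/-!
# Hu 2025 row 108 (§6.3), KERNEL NOTES on the typed carriers of `S06WpEllBlowups/R108aWpEllChart` + `R108bProp611Items`
# (M-Hu-min; typer of record res-type-081): three ring-level facts about the TYPED row-108 Props — nothing of the source asserted.

Source status (D-0012 / D-0089): Y. Hu, *Universal Characteristic-free Resolution of Singularities, I*, arXiv:2507.21400v1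
[Hu2025] — UNREFEREED PREPRINT UNDER ADJUDICATION; locators `C<cc>L<l>` = TeX chunk + line of `paper:arxiv-2507.21400`, PDF
page next to it. This file proves statements ABOUT OUR TYPED CARRIERS (the record `WpEllChart` and the `def … : Prop`
candidates of row 108); it asserts no statement of the preprint and takes no side. AI typing/proving, weaker than expert review.

1. `deltaLt_subset_del_of_labels` — the element-wise conjunct (iv) of `Prop6_11_labels` («𝔡^lt_𝔙 = {(m,u_F) ∣ L_F ∈ 𝔩_𝔙}
   ⊂ 𝔡_𝔙», C47L81; p.107) implies the set-level reading `WpEllChart.deltaLt ⊆ WpEllChart.del` (the reading of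
   res-type-029's split-v2 pre-draft; recorded so that both readings stay comparable in the kernel).
2. Def. 6.17's parenthetical «(at least one, hence both of) its two terms of B_𝔙 does not vanish at 𝐳» (C53L27; p.119):
   the typed claim `Def6_17_henceBoth C T⁺ T⁻` — which carries «B_𝔙 = T⁺ − T⁻ vanishes on 𝒱̃ ∩ 𝔙» as its explicit
   hypothesis `T⁺ - T⁻ ∈ C.vIdeal` (lane-B pre-read note N108-1) — HOLDS outright: `Def6_17_henceBoth_holds` (a one-line
   ideal computation, no use of maximality beyond the binder); and the hypothesis is NEEDED:
   `exists_terminatesAt_and_vanishing_term` (a chart record on `ℚ[X₀,X₁]` with `𝒱̃ ∩ 𝔙 = (X₀ = 0)` and the data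
   `T⁺ = 1`, `T⁻ = X₀`: «at least one term does not vanish» holds at a closed point of `𝒱̃ ∩ 𝔙` while the other term
   vanishes there). Data point for the lanes' vacuity column: the parenthetical is a one-line consequence of the
   defining-equations context, not an independent claim, and not true of arbitrary term data.
3. The OURS readings of «a set of free variables on the open chart» (file a): over a DOMAIN `R` and a nontrivial chart
   ring, the LOCALIZATION reading `IsFreeVariablesLoc` implies the ALGEBRAIC-INDEPENDENCE reading `IsFreeVariablesIndep`
   (`isFreeVariablesIndep_of_loc`); hence `Prop6_11_var_loc → Prop6_11_var_indep` (eq. (6.8)) and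
   `Prop6_11_varVee_loc → Prop6_11_varVee_indep` (eq. (6.9) = JOINT J4 / G-H11 of lit/PARTITION-HU.md §4), with the
   contrapositives `not_Prop6_11_var(Vee)_loc_of_not_indep` (a refutation at reading Indep is one at reading Loc). The
   converse and «Loc ⇒ Étale» are NOT claimed here.
4. The SHAPE OF A REFUTATION of J4 at reading Indep (index only, never a premise: the prior cell's
   `Hu2025/EllRestriction.lean` computes on a `Gr(3,5)` ℓ-chart that the ℓ-exceptional `δ_{𝔙,(m,u_F)}` equals a polynomial
   in another `Var^∨_𝔙`-variable): `not_algebraicIndependent_of_mem_adjoin` (a family one of whose members lies in the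
   subalgebra generated by the others is not algebraically independent; Mathlib `AlgebraicIndependent.transcendental_adjoin`)
   and, on OUR carrier, `not_Prop6_11_varVee_indep_of_mem_adjoin`: on an admissible chart record, if for some
   `(m,u_F) ∈ 𝔡^lt_𝔙` the ℓ-exceptional variable `δ_{𝔙,(m,u_F)}` lies in the `R`-subalgebra generated by the OTHER members
   of `Var^∨_𝔙`, then `Prop6_11_varVee_indep` fails (and so does `Prop6_11_varVee_loc` over a domain, item 3). Whether
   Hu's charts have this property is NOT decided here.
Hypotheses: none beyond the theorems' own binders — modulo []. Axioms: propext, Classical.choice, Quot.sound.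
-/

noncomputable section

open MvPolynomial

namespace Literature.AlgebraicGeometry.Hu2025.Statements.S06WpEllBlowups

namespace Prop611Readings

universe u₁ u₂ u₃ u₄ w

variable {ι₁ : Type u₁} {ι₂ : Type u₂} {ιF : Type u₃} {ιE : Type u₄} {A : Type w} [CommRing A] [DecidableEq ι₂]

/-- **Prop. 6.11, labels clause, conjunct (iv) «𝔡^lt_𝔙 ⊂ 𝔡_𝔙» (C47L81; p.107):** the element-wise typing of row 108
(`Prop6_11_labels`, last conjunct: every `F ∈ 𝔩_𝔙` has `ltIdx F = some uv` with `uv ∈ 𝔡_𝔙`) implies the set-level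
reading `deltaLt C ⊆ C.del` (`deltaLt = eraseNone (ell.image ltIdx)`).
[cite: Hu2025, Prop. 6.11 (labels clause) C47L70–L81, p. 107 (unrefereed preprint arXiv:2507.21400v1 under adjudication, D-0012/D-0089 — kernel support on OUR typed carrier of row 108; nothing of the source asserted)] -/
theorem deltaLt_subset_del_of_labels (C : WpEllChart ι₁ ι₂ ιF ιE A) (h : Prop6_11_labels C) :
    C.deltaLt ⊆ C.del := by
  intro uv huv
  simp only [WpEllChart.deltaLt, Finset.mem_eraseNone, Finset.mem_image] at huv
  obtain ⟨F, hF, hFuv⟩ := huv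
  obtain ⟨uv', h1, h2⟩ := h.2.2.2.2 F hF
  rw [hFuv] at h1
  cases h1
  exact h2

omit [DecidableEq ι₂] in
/-- **Def. 6.17, the parenthetical «(at least one, hence both of)» (C53L27; p.119) HOLDS as typed** (the typed claim
carries «B_𝔙 = T⁺ − T⁻ vanishes on 𝒱̃ ∩ 𝔙», `T⁺ - T⁻ ∈ C.vIdeal`, as its hypothesis): at every maximal ideal
`𝔪 ⊇ C.vIdeal`, `T⁺ ∈ 𝔪 ↔ T⁻ ∈ 𝔪`; no use of maximality beyond the binder. Tier-A discharge `Def6_17_henceBoth_holds`.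
[cite: Hu2025, Def. 6.17 C53L20–L33, p. 119 (unrefereed preprint arXiv:2507.21400v1 under adjudication, D-0012/D-0089 — kernel support on OUR typed carrier of row 108; nothing of the source asserted)] -/
theorem Def6_17_henceBoth_holds :
    ∀ (C : WpEllChart ι₁ ι₂ ιF ιE A) (Tplus Tminus : A), Def6_17_henceBoth C Tplus Tminus := by
  intro C Tplus Tminus h 𝔪 _ hle hor
  have hm : Tplus - Tminus ∈ 𝔪 := hle h
  have key : Tplus ∈ 𝔪 ↔ Tminus ∈ 𝔪 := by
    constructor
    · intro hp
      have := 𝔪.sub_mem hp hm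
      simpa using this
    · intro hq
      have := 𝔪.add_mem hm hq
      simpa using this
  rcases hor with hp | hq
  · exact ⟨hp, fun hq => hp (key.mpr hq)⟩
  · exact ⟨fun hp => hq (key.mp hp), hq⟩

/-- A coordinate variable of `ℚ[X₀,X₁]` is not a unit (used by the witness below).
[cite: Hu2025, Def. 6.17 C53L20–L33, p. 119 (unrefereed preprint arXiv:2507.21400v1 under adjudication, D-0012/D-0089 — kernel support on OUR typed carrier of row 108; nothing of the source asserted)] -/
theorem X_not_isUnit (i : Fin 2) : ¬ IsUnit (X i : MvPolynomial (Fin 2) ℚ) := by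
  intro h
  have h0 := (MvPolynomial.isUnit_iff_totalDegree_of_isReduced.mp h).2
  simp [MvPolynomial.totalDegree_X] at h0

/-- **The vanishing hypothesis of `Def6_17_henceBoth` is NEEDED (the bare «at least one ⇒ both» fails for arbitrary
term data):** on the chart record over `ℚ[X₀,X₁]` with `𝒱̃ ∩ 𝔙 = (X₀ = 0)` (labels/divisors irrelevant: `𝔢 = 𝔡 = 𝔩 = ∅`,
no exceptional divisor), the data `T⁺ = 1`, `T⁻ = X₀` satisfy Def. 6.17's «at least one term does not vanish at 𝐳»
(`TerminatesAt₆`) at a closed point `𝐳 = 𝔪 ⊇ (X₀)` of `𝒱̃ ∩ 𝔙`, while the other term `T⁻ = X₀` vanishes there. A toy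
on OUR carrier, not a model of Hu's charts (there `T⁺ − T⁻ = B_𝔙` vanishes on `𝒱̃ ∩ 𝔙`, which this data violates).
[cite: Hu2025, Def. 6.17 C53L20–L33, p. 119 (unrefereed preprint arXiv:2507.21400v1 under adjudication, D-0012/D-0089 — kernel support on OUR typed carrier of row 108; nothing of the source asserted)] -/
theorem exists_terminatesAt_and_vanishing_term :
    ∃ C : WpEllChart Unit Unit Unit Empty (MvPolynomial (Fin 2) ℚ), ∃ 𝔪 : Ideal (MvPolynomial (Fin 2) ℚ),
      TerminatesAt₆ C 1 (X 0) 𝔪 ∧ (X 0 : MvPolynomial (Fin 2) ℚ) ∈ 𝔪 := by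
  have hne : (Ideal.span {(X 0 : MvPolynomial (Fin 2) ℚ)}) ≠ ⊤ := Ideal.span_singleton_ne_top (X_not_isUnit 0)
  obtain ⟨𝔪, h𝔪, hle⟩ := Ideal.exists_le_maximal _ hne
  have h1 : (1 : MvPolynomial (Fin 2) ℚ) ∉ 𝔪 := fun h1 => h𝔪.ne_top ((Ideal.eq_top_iff_one _).mpr h1)
  have hX : (X 0 : MvPolynomial (Fin 2) ℚ) ∈ 𝔪 := hle (Ideal.subset_span rfl)
  exact ⟨WpEllChart.mk (eps := ∅) (del := ∅) (ell := ∅) (ltIdx := fun _ => none) (var₁ := fun _ => X 0)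
    (var₂ := fun _ => X 1) (deltaEll := fun _ => 0) (plDiv := fun _ => Ideal.span {X 0})
    (rhoDiv := fun _ => Ideal.span {X 1}) (excDiv := fun e => e.elim) (lab := fun e => e.elim)
    (ellForm := fun _ => 1) (vIdeal := Ideal.span {X 0}), 𝔪, ⟨h𝔪, hle, Or.inl h1⟩, hX⟩

/-! ### The two OURS readings of «set of free variables»: localization ⇒ algebraic independence (over a domain) -/

omit [DecidableEq ι₂] in
/-- **«Set of free variables on the open chart» (§3 C18L83–L88, p.38–39; Prop. 6.11 proof C50L123–L124 / C50L135–L137,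
p.114), OURS readings of file a:** over a DOMAIN `R` and a nontrivial `R`-algebra `B`, the LOCALIZATION reading
`IsFreeVariablesLoc R v` implies the ALGEBRAIC-INDEPENDENCE reading `IsFreeVariablesIndep R v`. Proof: `B ≃ M⁻¹R[σ]`
with `0 ∉ M` (else `B = 0`), and `R[σ]` is a domain, so `R[σ] → B` is injective.
[cite: Hu2025, Prop. 6.11 eqs. (6.8)/(6.9) C47L99–L141, pp. 107–108 (unrefereed preprint arXiv:2507.21400v1 under adjudication, D-0012/D-0089 — kernel support on OUR typed carrier of row 108; nothing of the source asserted)] -/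
theorem isFreeVariablesIndep_of_loc {R : Type*} [CommRing R] [IsDomain R] {σ : Type*} {B : Type*} [CommRing B]
    [Algebra R B] [Nontrivial B] (v : σ → B) (h : IsFreeVariablesLoc R v) : IsFreeVariablesIndep R v := by
  obtain ⟨M, hM⟩ := h
  letI : Algebra (MvPolynomial σ R) B := (MvPolynomial.aeval v).toRingHom.toAlgebra
  have h0 : (0 : MvPolynomial σ R) ∉ M := by
    intro h0
    haveI := IsLocalization.subsingleton (S := B) h0
    exact false_of_nontrivial_of_subsingleton B
  have hle : M ≤ nonZeroDivisors (MvPolynomial σ R) := fun p hp =>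
    mem_nonZeroDivisors_of_ne_zero (fun h => h0 (h ▸ hp))
  have hinj := IsLocalization.injective B hle
  exact hinj

omit [DecidableEq ι₂] in
/-- **Eq. (6.8) (C47L99–L118, p.107):** over a domain `R`, `Prop6_11_var` at the Loc reading implies it at the Indep
reading (nontriviality of the chart ring from `IsAdmissible`).
[cite: Hu2025, Prop. 6.11 eq. (6.8) C47L99–L118, p. 107 (unrefereed preprint arXiv:2507.21400v1 under adjudication, D-0012/D-0089 — kernel support on OUR typed carrier of row 108; nothing of the source asserted)] -/
theorem Prop6_11_var_indep_of_loc {R : Type*} [CommRing R] [IsDomain R] [Algebra R A]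
    (C : WpEllChart ι₁ ι₂ ιF ιE A) (h : Prop6_11_var_loc (R := R) C) : Prop6_11_var_indep (R := R) C := by
  intro hadm
  haveI : Nontrivial A := by
    by_contra htriv
    rw [not_nontrivial_iff_subsingleton] at htriv
    exact hadm (Subsingleton.elim _ _)
  exact isFreeVariablesIndep_of_loc C.var (h hadm)

/-- **Eq. (6.9) = JOINT J4 (C47L135–L141, p.108):** over a domain `R`, `Prop6_11_varVee` at the Loc reading implies it at
the Indep reading — a verdict on J4 at the reading Loc transfers to the reading Indep (the converse is not claimed).
[cite: Hu2025, Prop. 6.11 eq. (6.9) C47L135–L141, p. 108 (unrefereed preprint arXiv:2507.21400v1 under adjudication, D-0012/D-0089 — kernel support on OUR typed carrier of row 108; nothing of the source asserted)] -/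
theorem Prop6_11_varVee_indep_of_loc {R : Type*} [CommRing R] [IsDomain R] [Algebra R A]
    (C : WpEllChart ι₁ ι₂ ιF ιE A) (h : Prop6_11_varVee_loc (R := R) C) : Prop6_11_varVee_indep (R := R) C := by
  intro hadm
  haveI : Nontrivial A := by
    by_contra htriv
    rw [not_nontrivial_iff_subsingleton] at htriv
    exact hadm (Subsingleton.elim _ _)
  exact isFreeVariablesIndep_of_loc C.varVee (h hadm)

/-- **Contrapositive for the J4 readers (eq. (6.9), C47L135–L141, p.108):** over a domain `R`, if `Var^∨_𝔙` is NOT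
algebraically independent on an admissible chart (reading Indep refuted — cf. the index entry `Hu2025/EllRestriction.lean`
of the prior cell, never a premise here), then the LOCALIZATION reading of `Prop6_11_varVee` is refuted as well.
[cite: Hu2025, Prop. 6.11 eq. (6.9) C47L135–L141, p. 108 (unrefereed preprint arXiv:2507.21400v1 under adjudication, D-0012/D-0089 — kernel support on OUR typed carrier of row 108; nothing of the source asserted)] -/
theorem not_Prop6_11_varVee_loc_of_not_indep {R : Type*} [CommRing R] [IsDomain R] [Algebra R A]
    (C : WpEllChart ι₁ ι₂ ιF ιE A) (h : ¬ Prop6_11_varVee_indep (R := R) C) : ¬ Prop6_11_varVee_loc (R := R) C :=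
  fun hloc => h (Prop6_11_varVee_indep_of_loc C hloc)

omit [DecidableEq ι₂] in
/-- **Contrapositive for eq. (6.8) (C47L99–L118, p.107):** over a domain `R`, a refutation of `Prop6_11_var` at the
reading Indep refutes it at the reading Loc.
[cite: Hu2025, Prop. 6.11 eq. (6.8) C47L99–L118, p. 107 (unrefereed preprint arXiv:2507.21400v1 under adjudication, D-0012/D-0089 — kernel support on OUR typed carrier of row 108; nothing of the source asserted)] -/
theorem not_Prop6_11_var_loc_of_not_indep {R : Type*} [CommRing R] [IsDomain R] [Algebra R A]
    (C : WpEllChart ι₁ ι₂ ιF ιE A) (h : ¬ Prop6_11_var_indep (R := R) C) : ¬ Prop6_11_var_loc (R := R) C :=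
  fun hloc => h (Prop6_11_var_indep_of_loc C hloc)

/-! ### The shape of a refutation of J4 at the reading Indep (schema on OUR carrier; nothing decided about Hu's charts) -/

omit [DecidableEq ι₂] in
/-- **Schema:** in a nontrivial `R`-algebra, a family `x` one of whose members `x i` lies in the `R`-subalgebra generated
by the other members is not algebraically independent (Mathlib `AlgebraicIndependent.transcendental_adjoin` +
`isAlgebraic_algebraMap`). Used for eq. (6.9) below.
[cite: Hu2025, Prop. 6.11 eq. (6.9) C47L135–L141, p. 108 (unrefereed preprint arXiv:2507.21400v1 under adjudication, D-0012/D-0089 — kernel support on OUR typed carrier of row 108; nothing of the source asserted)] -/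
theorem not_algebraicIndependent_of_mem_adjoin {R : Type*} [CommRing R] {κ : Type*} {B : Type*} [CommRing B]
    [Algebra R B] [Nontrivial B] (x : κ → B) (i : κ) (h : x i ∈ Algebra.adjoin R (x '' {i}ᶜ)) :
    ¬ AlgebraicIndependent R x := by
  intro hx
  have hi : i ∉ ({i}ᶜ : Set κ) := by simp
  exact hx.transcendental_adjoin hi (isAlgebraic_algebraMap (⟨x i, h⟩ : Algebra.adjoin R (x '' {i}ᶜ)))

/-- **Eq. (6.9) = JOINT J4 (C47L135–L141, p.108; proof sentence C50L135–L137, p.114), the SHAPE OF A REFUTATION at the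
reading Indep on OUR carrier:** on an admissible chart record `C` (so the chart ring is nontrivial), if for some index
`(m,u_F) ∈ 𝔡^lt_𝔙` the ℓ-exceptional variable `δ_{𝔙,(m,u_F)}` (the `Var^∨_𝔙`-member of that index, `WpEllChart.delta`)
lies in the `R`-subalgebra generated by the OTHER members of `Var^∨_𝔙`, then `Prop6_11_varVee_indep C` fails. (Index
only, never a premise: the prior cell's `Hu2025/EllRestriction.lean` exhibits `δ_(123,145) = x_(134,125) − 1` on a
`Gr(3,5)` ℓ-chart.) Whether Hu's charts satisfy the hypothesis is NOT decided here.
[cite: Hu2025, Prop. 6.11 eq. (6.9) C47L135–L141, p. 108 (unrefereed preprint arXiv:2507.21400v1 under adjudication, D-0012/D-0089 — kernel support on OUR typed carrier of row 108; nothing of the source asserted)] -/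
theorem not_Prop6_11_varVee_indep_of_mem_adjoin {R : Type*} [CommRing R] [Algebra R A]
    (C : WpEllChart ι₁ ι₂ ιF ιE A) (hadm : IsAdmissible C) (uv : ι₂) (huv : uv ∈ C.deltaLt)
    (h : C.deltaEll uv ∈ Algebra.adjoin R (C.varVee '' {(Sum.inr uv : ι₁ ⊕ ι₂)}ᶜ)) :
    ¬ Prop6_11_varVee_indep (R := R) C := by
  intro hP
  haveI : Nontrivial A := by
    by_contra htriv
    rw [not_nontrivial_iff_subsingleton] at htriv
    exact hadm (Subsingleton.elim _ _)
  have hx : AlgebraicIndependent R C.varVee := hP hadm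
  refine not_algebraicIndependent_of_mem_adjoin (R := R) C.varVee (Sum.inr uv) ?_ hx
  have hval : C.varVee (Sum.inr uv) = C.deltaEll uv := by
    simp [WpEllChart.varVee, WpEllChart.delta, huv]
  rw [hval]
  exact h

/-- **The same refutation shape transferred to the reading Loc (over a domain `R`; item 3).**
[cite: Hu2025, Prop. 6.11 eq. (6.9) C47L135–L141, p. 108 (unrefereed preprint arXiv:2507.21400v1 under adjudication, D-0012/D-0089 — kernel support on OUR typed carrier of row 108; nothing of the source asserted)] -/
theorem not_Prop6_11_varVee_loc_of_mem_adjoin {R : Type*} [CommRing R] [IsDomain R] [Algebra R A]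
    (C : WpEllChart ι₁ ι₂ ιF ιE A) (hadm : IsAdmissible C) (uv : ι₂) (huv : uv ∈ C.deltaLt)
    (h : C.deltaEll uv ∈ Algebra.adjoin R (C.varVee '' {(Sum.inr uv : ι₁ ⊕ ι₂)}ᶜ)) :
    ¬ Prop6_11_varVee_loc (R := R) C :=
  not_Prop6_11_varVee_loc_of_not_indep C (not_Prop6_11_varVee_indep_of_mem_adjoin C hadm uv huv h)

end Prop611Readings

end Literature.AlgebraicGeometry.Hu2025.Statements.S06WpEllBlowups

end
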